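import Mathlib
import Literature.Analysis.FluidPDE.CKNInterpolationEstimate
import Literature.Analysis.FluidPDE.CKNMorreyQuadraticMean
import Literature.Analysis.FunctionSpaces.SobolevBallScaling
import HarnessLib

/-!
# ConservativeEngine — tools for the support `FloorForcesGaugedEnergy` (stmt-NavierStokesRegularity-28362)

Route `ConservativeEngine` (decomp-ns node N30, rev 6 after W3 «THE ATOM SWAP»). Route-independent
analysis lemmas (Mathlib + Literature imports only; Hölder in time is the tree's
`Literature.Analysis.FluidPDE.lintegral_rpow_three_quarters_le_mul_univ`) used by
`Theorems/ConservativeEngineFloorForcesGaugedEnergy.lean`, which proves the support as typed: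

* `exists_small_eta` — the small constant `η₀(ε₀, M, K)`;
* `rpow_bookkeeping` — the powers of `r` cancel: `(2ρ-2) + ¾(1-2ρ) + ¾(1-ρ) + ¼(2+ρ) = 0`;
* `exists_sobolev_six_ball` — scale-invariant Sobolev `H¹(B_r) ⊂ L⁶(B_r)` for fields `ℝ³ → ℝ³`
  (`FunctionSpaces.exists_eLpNorm_le_ball`, `p = 2 → 6`);
* `slice_cubic_le` — the one-slice CKN interpolation `∫_{B_r}|f|³ ≤ ā^{3/4}(2C_S)^{3/2}(r⁻²ā + ∫_{B_r}|∇f|²)^{3/4}`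
  (Caffarelli–Kohn–Nirenberg 1982, §2 (2.8)–(2.10); Robinson–Rodrigo–Sadowski 2016, Lemma 15.10);
* `parabolicCylinderOpens_mono` — nested cylinders.

No new definitions; Navier–Stokes regularity is NOT proved by anything here (rung 0).
-/

-- the summit and its single sub-problem share the name (CONVENTIONS §1), as in every Theorems file
set_option linter.dupNamespace false

noncomputable section

open scoped NNReal ENNReal Topology
open MeasureTheory Set Metric Filter Function TopologicalSpace Module
open Literature.Analysis Literature.Analysis.FluidPDE

namespace Summit.NavierStokesRegularity.NavierStokesRegularity.Theorems.ConservativeEngine.FloorTools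

/-! ### Elementary tools -/

/-- The small constant: for `K, M ≥ 0` and `ε > 0` there is `0 < η ≤ 1` with
`K (η (M + 1))^{3/4} < ε`. [folklore] -/
theorem exists_small_eta (K M : ℝ≥0) {ε : ℝ} (hε : 0 < ε) :
    ∃ η : ℝ≥0, 0 < η ∧ η ≤ 1 ∧
      (K : ℝ≥0∞) * (((η : ℝ≥0∞) * ((M : ℝ≥0∞) + 1)) ^ (3 / 4 : ℝ)) < ENNReal.ofReal ε := by
  set ε' : ℝ≥0 := ε.toNNReal with hε'
  have hε'0 : 0 < ε' := Real.toNNReal_pos.2 hε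
  set t : ℝ≥0 := min 1 (ε' / (2 * (K + 1))) with ht
  have ht0 : 0 < t := lt_min one_pos (div_pos hε'0 (by positivity))
  have ht1 : t ≤ 1 := min_le_left _ _
  have ht2 : t ≤ ε' / (2 * (K + 1)) := min_le_right _ _
  have hM1 : (M + 1 : ℝ≥0) ≠ 0 := by positivity
  set η : ℝ≥0 := t ^ 4 / (M + 1) with hη
  have hηM : η * (M + 1) = t ^ 4 := div_mul_cancel₀ _ hM1
  refine ⟨η, div_pos (pow_pos ht0 4) (by positivity), ?_, ?_⟩
  · calc η ≤ η * (M + 1) := le_mul_of_one_le_right zero_le le_add_self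
      _ = t ^ 4 := hηM
      _ ≤ 1 := pow_le_one₀ zero_le ht1
  · have h34 : ((t ^ 4 : ℝ≥0) : ℝ≥0) ^ (3 / 4 : ℝ) = t ^ 3 := by
      rw [← NNReal.rpow_natCast t 4, ← NNReal.rpow_mul,
        show ((4 : ℕ) : ℝ) * (3 / 4) = ((3 : ℕ) : ℝ) by norm_num, NNReal.rpow_natCast]
    have hlhs : (K : ℝ≥0∞) * (((η : ℝ≥0∞) * ((M : ℝ≥0∞) + 1)) ^ (3 / 4 : ℝ)) =
        ((K * t ^ 3 : ℝ≥0) : ℝ≥0∞) := by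
      rw [show ((η : ℝ≥0∞) * ((M : ℝ≥0∞) + 1)) = ((η * (M + 1) : ℝ≥0) : ℝ≥0∞) by push_cast; rfl,
        hηM, ← ENNReal.coe_rpow_of_nonneg _ (by norm_num), h34, ENNReal.coe_mul]
    have hrhs : ENNReal.ofReal ε = ((ε' : ℝ≥0) : ℝ≥0∞) := rfl
    rw [hlhs, hrhs, ENNReal.coe_lt_coe, ← NNReal.coe_lt_coe]
    have hK : (0 : ℝ) ≤ K := K.coe_nonneg
    have ht0' : (0 : ℝ) < t := ht0
    have ht1' : (t : ℝ) ≤ 1 := ht1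
    have ht2' : (t : ℝ) ≤ ε' / (2 * (K + 1)) := by exact_mod_cast ht2
    have ht3 : (t : ℝ) ^ 3 ≤ t := pow_le_of_le_one ht0'.le ht1' (by norm_num)
    have hε'' : (0 : ℝ) < ε' := hε'0
    push_cast
    calc (K : ℝ) * (t : ℝ) ^ 3 ≤ K * t := by gcongr
      _ ≤ (K + 1) * t := by gcongr; linarith
      _ ≤ (K + 1) * (ε' / (2 * (K + 1))) := by gcongr
      _ = ε' / 2 := by field_simp
      _ < ε' := by linarith

/-- Exponent bookkeeping: the powers of `r` collected along the proof cancel,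
`(2ρ-2) + ¾(1-2ρ) + ¾(1-ρ) + ¼(2+ρ) = 0`. [folklore] -/
theorem rpow_bookkeeping {Rr : ℝ≥0∞} (h0 : Rr ≠ 0) (ht : Rr ≠ ⊤) (ρ : ℝ) (η M Kc : ℝ≥0∞) :
    Rr ^ (2 * ρ - 2) * ((Rr ^ (1 - 2 * ρ) * η) ^ (3 / 4 : ℝ) * Kc *
      ((Rr ^ (1 - ρ) * (η + M)) ^ (3 / 4 : ℝ) * (Rr ^ (2 + ρ)) ^ (1 / 4 : ℝ))) =
      Kc * (η ^ (3 / 4 : ℝ) * (η + M) ^ (3 / 4 : ℝ)) := by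
  rw [ENNReal.mul_rpow_of_nonneg _ _ (by norm_num : (0 : ℝ) ≤ 3 / 4),
    ENNReal.mul_rpow_of_nonneg _ _ (by norm_num : (0 : ℝ) ≤ 3 / 4), ← ENNReal.rpow_mul,
    ← ENNReal.rpow_mul, ← ENNReal.rpow_mul]
  have hcollect : Rr ^ (2 * ρ - 2) * Rr ^ ((1 - 2 * ρ) * (3 / 4 : ℝ)) *
      Rr ^ ((1 - ρ) * (3 / 4 : ℝ)) * Rr ^ ((2 + ρ) * (1 / 4 : ℝ)) = 1 := by
    rw [← ENNReal.rpow_add _ _ h0 ht, ← ENNReal.rpow_add _ _ h0 ht, ← ENNReal.rpow_add _ _ h0 ht,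
      show 2 * ρ - 2 + (1 - 2 * ρ) * (3 / 4 : ℝ) + (1 - ρ) * (3 / 4 : ℝ) + (2 + ρ) * (1 / 4 : ℝ) = 0 by
        ring, ENNReal.rpow_zero]
  calc Rr ^ (2 * ρ - 2) * (Rr ^ ((1 - 2 * ρ) * (3 / 4 : ℝ)) * η ^ (3 / 4 : ℝ) * Kc *
        (Rr ^ ((1 - ρ) * (3 / 4 : ℝ)) * (η + M) ^ (3 / 4 : ℝ) * Rr ^ ((2 + ρ) * (1 / 4 : ℝ))))
      = (Rr ^ (2 * ρ - 2) * Rr ^ ((1 - 2 * ρ) * (3 / 4 : ℝ)) *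
          Rr ^ ((1 - ρ) * (3 / 4 : ℝ)) * Rr ^ ((2 + ρ) * (1 / 4 : ℝ))) *
          (Kc * (η ^ (3 / 4 : ℝ) * (η + M) ^ (3 / 4 : ℝ))) := by ring
    _ = Kc * (η ^ (3 / 4 : ℝ) * (η + M) ^ (3 / 4 : ℝ)) := by rw [hcollect, one_mul]

/-! ### The slice estimate: Sobolev on `B_r` and Hölder -/

/-- **The scale-invariant Sobolev inequality `H¹(B_r) ⊂ L⁶(B_r)`** for fields `ℝ³ → ℝ³`
(`FunctionSpaces.exists_eLpNorm_le_ball` with `p = 2`, `p' = 6`, `n = 3`):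
`‖f‖_{L⁶(B_r)} ≤ C_S (r⁻¹ ‖f‖_{L²(B_r)} + ‖g‖_{L²(B_r)})`. [cite: CaffarelliKohnNirenberg1982, §2 (2.8)–(2.10)] -/
theorem exists_sobolev_six_ball :
    ∃ CS : ℝ≥0, ∀ (x₀ : EuclideanSpace ℝ (Fin 3)) (r : ℝ), 0 < r →
      ∀ (f : EuclideanSpace ℝ (Fin 3) → EuclideanSpace ℝ (Fin 3))
        (g : EuclideanSpace ℝ (Fin 3) → EuclideanSpace ℝ (Fin 3) →L[ℝ] EuclideanSpace ℝ (Fin 3)),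
      FunctionSpaces.MemSobolevDomain 1 ((2 : ℝ≥0) : ℝ≥0∞)
        (⟨ball x₀ r, isOpen_ball⟩ : Opens (EuclideanSpace ℝ (Fin 3))) volume f →
      FunctionSpaces.HasWeakFDerivOn
        (⟨ball x₀ r, isOpen_ball⟩ : Opens (EuclideanSpace ℝ (Fin 3))) volume f g →
      eLpNorm f 6 (volume.restrict (ball x₀ r)) ≤
        CS * ((ENNReal.ofReal r)⁻¹ * eLpNorm f 2 (volume.restrict (ball x₀ r)) +
          eLpNorm g 2 (volume.restrict (ball x₀ r))) := by
  obtain ⟨C, hC⟩ := FunctionSpaces.exists_eLpNorm_le_ball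
    (E := EuclideanSpace ℝ (Fin 3)) (F := EuclideanSpace ℝ (Fin 3)) (p := 2) (p' := 6) one_le_two
    (by rw [finrank_euclideanSpace_fin]; norm_num) (by rw [finrank_euclideanSpace_fin]; norm_num)
  refine ⟨C, fun x₀ r hr f g hf hg => ?_⟩
  have := hC x₀ r hr f g hf hg
  simpa only [ENNReal.coe_ofNat] using this

/-- **The slice estimate** (CKN 1982, (2.8)–(2.10) on one time slice): for `f` with weak
derivative `g` on `B_r(x₀)`, `∫_{B_r} |f|² ≤ ā < ∞` and `e = ∫_{B_r} |g|² < ∞`,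
`∫_{B_r} |f|³ ≤ ā^{3/4} (2C_S)^{3/2} (r⁻² ā + e)^{3/4}`. [cite: CaffarelliKohnNirenberg1982, §2 (2.8)–(2.10)] -/
theorem slice_cubic_le {CS : ℝ≥0}
    (hCS : ∀ (x₀ : EuclideanSpace ℝ (Fin 3)) (r : ℝ), 0 < r →
      ∀ (f : EuclideanSpace ℝ (Fin 3) → EuclideanSpace ℝ (Fin 3))
        (g : EuclideanSpace ℝ (Fin 3) → EuclideanSpace ℝ (Fin 3) →L[ℝ] EuclideanSpace ℝ (Fin 3)),
      FunctionSpaces.MemSobolevDomain 1 ((2 : ℝ≥0) : ℝ≥0∞)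
        (⟨ball x₀ r, isOpen_ball⟩ : Opens (EuclideanSpace ℝ (Fin 3))) volume f →
      FunctionSpaces.HasWeakFDerivOn
        (⟨ball x₀ r, isOpen_ball⟩ : Opens (EuclideanSpace ℝ (Fin 3))) volume f g →
      eLpNorm f 6 (volume.restrict (ball x₀ r)) ≤
        CS * ((ENNReal.ofReal r)⁻¹ * eLpNorm f 2 (volume.restrict (ball x₀ r)) +
          eLpNorm g 2 (volume.restrict (ball x₀ r))))
    {x₀ : EuclideanSpace ℝ (Fin 3)} {r : ℝ} (hr : 0 < r)
    {f : EuclideanSpace ℝ (Fin 3) → EuclideanSpace ℝ (Fin 3)}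
    {g : EuclideanSpace ℝ (Fin 3) → EuclideanSpace ℝ (Fin 3) →L[ℝ] EuclideanSpace ℝ (Fin 3)}
    (hw : FunctionSpaces.HasWeakFDerivOn
      (⟨ball x₀ r, isOpen_ball⟩ : Opens (EuclideanSpace ℝ (Fin 3))) volume f g)
    {abar : ℝ≥0∞} (ha : ∫⁻ x in ball x₀ r, ‖f x‖ₑ ^ 2 ≤ abar) (habar : abar ≠ ⊤)
    (he : ∫⁻ x in ball x₀ r, ENNReal.ofReal (frobeniusNormSq (g x)) ≠ ⊤) :
    ∫⁻ x in ball x₀ r, ‖f x‖ₑ ^ (3 : ℕ) ≤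
      abar ^ (3 / 4 : ℝ) * (((2 * CS : ℝ≥0) : ℝ≥0∞) ^ (3 / 2 : ℝ) *
        ((ENNReal.ofReal r) ^ (-2 : ℝ) * abar +
          ∫⁻ x in ball x₀ r, ENNReal.ofReal (frobeniusNormSq (g x))) ^ (3 / 4 : ℝ)) := by
  set B : Set (EuclideanSpace ℝ (Fin 3)) := ball x₀ r with hB
  set a : ℝ≥0∞ := ∫⁻ x in B, ‖f x‖ₑ ^ 2 with hadef
  set e : ℝ≥0∞ := ∫⁻ x in B, ENNReal.ofReal (frobeniusNormSq (g x)) with hedef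
  set Rr : ℝ≥0∞ := ENNReal.ofReal r with hRr
  have hR0 : Rr ≠ 0 := (ENNReal.ofReal_pos.2 hr).ne'
  have hRt : Rr ≠ ⊤ := ENNReal.ofReal_ne_top
  have hat : a ≠ ⊤ := ne_top_of_le_ne_top habar ha
  -- measurability and `L²` membership of the slice and its gradient
  have hfm : AEStronglyMeasurable f (volume.restrict B) := hw.locallyIntegrableOn.aestronglyMeasurable
  have hL2 : eLpNorm f 2 (volume.restrict B) = a ^ (1 / 2 : ℝ) := by
    rw [eLpNorm_eq_lintegral_rpow_enorm_toReal two_ne_zero ENNReal.ofNat_ne_top,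
      ENNReal.toReal_ofNat, hadef]
    simp only [one_div]
    congr 1
    refine lintegral_congr fun x => ?_
    rw [show (2 : ℝ) = ((2 : ℕ) : ℝ) by norm_num, ENNReal.rpow_natCast]
  have hL2' : eLpNorm f 2 (volume.restrict B) ≠ ⊤ := by
    rw [hL2]; exact ENNReal.rpow_ne_top_of_nonneg (by norm_num) hat
  have hf2 : MemLp f 2 (volume.restrict B) := ⟨hfm, lt_top_iff_ne_top.2 hL2'⟩
  have hgm : AEStronglyMeasurable g (volume.restrict B) :=
    hw.locallyIntegrableOn_deriv.aestronglyMeasurable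
  have hg2 := eLpNorm_two_le_lintegral_frobeniusNormSq_rpow (volume.restrict B) g
  have hg : MemLp g 2 (volume.restrict B) :=
    ⟨hgm, hg2.trans_lt (ENNReal.rpow_lt_top_of_nonneg (by norm_num) he)⟩
  have hsob : FunctionSpaces.MemSobolevDomain 1 ((2 : ℝ≥0) : ℝ≥0∞)
      (⟨B, isOpen_ball⟩ : Opens (EuclideanSpace ℝ (Fin 3))) volume f := by
    refine FunctionSpaces.memSobolevDomain_succ_iff.2 ⟨by exact_mod_cast hf2, g, hw, fun v => ?_⟩
    rw [FunctionSpaces.memSobolevDomain_zero_iff]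
    exact_mod_cast (ContinuousLinearMap.apply ℝ (EuclideanSpace ℝ (Fin 3)) v).comp_memLp' hg
  -- Sobolev on the slice
  have hD : Rr⁻¹ * abar ^ (1 / 2 : ℝ) = (Rr ^ (-2 : ℝ) * abar) ^ (1 / 2 : ℝ) := by
    rw [ENNReal.mul_rpow_of_nonneg _ _ (by norm_num : (0 : ℝ) ≤ 1 / 2), ← ENNReal.rpow_mul,
      show (-2 : ℝ) * (1 / 2) = -1 by norm_num, ENNReal.rpow_neg_one]
  have hS : eLpNorm f 6 (volume.restrict B) ≤
      CS * ((Rr ^ (-2 : ℝ) * abar) ^ (1 / 2 : ℝ) + e ^ (1 / 2 : ℝ)) := by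
    have h1 := hCS x₀ r hr f g hsob hw
    rw [hL2] at h1
    refine h1.trans ?_
    rw [← hD]
    gcongr
  have hS2 : eLpNorm f 6 (volume.restrict B) ≤
      ((2 * CS : ℝ≥0) : ℝ≥0∞) * (Rr ^ (-2 : ℝ) * abar + e) ^ (1 / 2 : ℝ) := by
    refine hS.trans ?_
    have h1' : (Rr ^ (-2 : ℝ) * abar) ^ (1 / 2 : ℝ) ≤ (Rr ^ (-2 : ℝ) * abar + e) ^ (1 / 2 : ℝ) :=
      ENNReal.rpow_le_rpow le_self_add (by norm_num)
    have h2' : e ^ (1 / 2 : ℝ) ≤ (Rr ^ (-2 : ℝ) * abar + e) ^ (1 / 2 : ℝ) :=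
      ENNReal.rpow_le_rpow le_add_self (by norm_num)
    calc (CS : ℝ≥0∞) * ((Rr ^ (-2 : ℝ) * abar) ^ (1 / 2 : ℝ) + e ^ (1 / 2 : ℝ))
        ≤ CS * ((Rr ^ (-2 : ℝ) * abar + e) ^ (1 / 2 : ℝ) + (Rr ^ (-2 : ℝ) * abar + e) ^ (1 / 2 : ℝ)) := by
          gcongr
      _ = ((2 * CS : ℝ≥0) : ℝ≥0∞) * (Rr ^ (-2 : ℝ) * abar + e) ^ (1 / 2 : ℝ) := by push_cast; ring
  -- `(∫ |f|⁶)^{1/4} = ‖f‖_{L⁶}^{3/2}`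
  have hL6 : (∫⁻ x in B, ‖f x‖ₑ ^ (6 : ℝ)) ^ (1 / 4 : ℝ) =
      eLpNorm f 6 (volume.restrict B) ^ (3 / 2 : ℝ) := by
    rw [eLpNorm_eq_lintegral_rpow_enorm_toReal (by norm_num) ENNReal.ofNat_ne_top,
      ENNReal.toReal_ofNat, ← ENNReal.rpow_mul]
    norm_num
  -- Hölder in space and assembly
  have hH := lintegral_pow_three_le_Lp_interpolation (volume.restrict B) hfm.enorm
  calc ∫⁻ x in B, ‖f x‖ₑ ^ (3 : ℕ)
      ≤ a ^ (3 / 4 : ℝ) * (∫⁻ x in B, ‖f x‖ₑ ^ (6 : ℝ)) ^ (1 / 4 : ℝ) := hH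
    _ = a ^ (3 / 4 : ℝ) * eLpNorm f 6 (volume.restrict B) ^ (3 / 2 : ℝ) := by rw [hL6]
    _ ≤ abar ^ (3 / 4 : ℝ) *
        (((2 * CS : ℝ≥0) : ℝ≥0∞) * (Rr ^ (-2 : ℝ) * abar + e) ^ (1 / 2 : ℝ)) ^ (3 / 2 : ℝ) := by
        gcongr
    _ = abar ^ (3 / 4 : ℝ) * (((2 * CS : ℝ≥0) : ℝ≥0∞) ^ (3 / 2 : ℝ) *
        (Rr ^ (-2 : ℝ) * abar + e) ^ (3 / 4 : ℝ)) := by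
        rw [ENNReal.mul_rpow_of_nonneg _ _ (by norm_num), ← ENNReal.rpow_mul]
        norm_num

/-! ### Nested cylinders -/

/-- Parabolic cylinders with a common centre are nested in the radius. [folklore] -/
theorem parabolicCylinderOpens_mono {r r' : ℝ} (hr : 0 ≤ r) (h : r ≤ r')
    (z : ℝ × EuclideanSpace ℝ (Fin 3)) :
    parabolicCylinderOpens r z ≤ parabolicCylinderOpens r' z := by
  intro p hp
  have hp' : p ∈ parabolicCylinder r z := hp
  show p ∈ parabolicCylinder r' z
  unfold parabolicCylinder at hp' ⊢
  refine Set.prod_mono (Set.Ioo_subset_Ioo ?_ le_rfl) (ball_subset_ball h) hp'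
  have : r ^ 2 ≤ r' ^ 2 := pow_le_pow_left₀ hr h 2
  linarith

end Summit.NavierStokesRegularity.NavierStokesRegularity.Theorems.ConservativeEngine.FloorTools
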